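import Summits.MatrixMultiplication.MatrixMultiplication.Theorems.OutsiderSandwichToricCeilingPowTwoCwBaseDataA

/-!
# OutsiderSandwich — toric ceiling of `cw₂^{⊠N}`: the `N = 3` two-cw base census, kernel checks A
(groups `cX0`, `cX1`, `cX2`; decomp-mm lens 4, gen 47, kernel K47-6 census A; THESES-FREE, `ω`-free;
helper toward `LaserTangency`, stmt-32268)

LABEL.  TORIC · FINITE (`N = 3`) · NEC-side instrument.  For each group `cXk`: the certificate list
`datak` (`…TwoCwBaseDataA`) has the length of the instance list `instOf cXk` (`lenk`), and — in
CHUNKS of at most 150 instances, to respect the kernel's memory ceiling on the gate — every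
certificate decodes to a `valid` perfect matching of `cw ⊠ cw ⊠ D` minus its instance
(`censusk_r`, `decide +kernel`, standard axioms; no `native_decide`, no `ofReduceBool`); `coverk`
records that the chunks cover all indices.  Consumed by `…TwoCwBase` (`good_k`, `census_all`).
WHAT THIS IS NOT: no statement about tensors or `ω`.
-/

set_option linter.dupNamespace false
set_option maxRecDepth 200000
set_option Elab.async false

namespace Summit.MatrixMultiplication.MatrixMultiplication.Theorems.OutsiderSandwichToricCeilingPowTwoCwBaseCensusA

open Summit.MatrixMultiplication.MatrixMultiplication.Theorems.OutsiderSandwichToricCeilingPowTwoCwBaseDefs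
open Summit.MatrixMultiplication.MatrixMultiplication.Theorems.OutsiderSandwichToricCeilingPowTwoCwBaseDataA

set_option maxHeartbeats 0 in
/-- Group `cX0`: the certificate list has the length of the instance list (360). -/
theorem len0 : (instOf cX0).length = data0.length := by
  decide +kernel

/-- Group `cX0`: number of certificates. -/
theorem dlen0 : data0.length = 360 := by
  decide +kernel

set_option maxHeartbeats 0 in
/-- CENSUS, group `cX0`, instances `0 … 149` (kernel-decided): each certificate decodes to a valid
perfect matching of its instance. -/
theorem census0_0 : ((((instOf cX0).zip data0).drop 0).take 150).all
    (fun p => goodD p.1 p.2) = true := by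
  decide +kernel

set_option maxHeartbeats 0 in
/-- CENSUS, group `cX0`, instances `150 … 299` (kernel-decided): each certificate decodes to a valid
perfect matching of its instance. -/
theorem census0_1 : ((((instOf cX0).zip data0).drop 150).take 150).all
    (fun p => goodD p.1 p.2) = true := by
  decide +kernel

set_option maxHeartbeats 0 in
/-- CENSUS, group `cX0`, instances `300 … 359` (kernel-decided): each certificate decodes to a valid
perfect matching of its instance. -/
theorem census0_2 : ((((instOf cX0).zip data0).drop 300).take 60).all
    (fun p => goodD p.1 p.2) = true := by
  decide +kernel

/-- Group `cX0`: every index is covered by a decided chunk. -/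
theorem cover0 : ∀ i < data0.length, ∃ lo n, lo ≤ i ∧ i < lo + n ∧
    ((((instOf cX0).zip data0).drop lo).take n).all (fun p => goodD p.1 p.2) = true := by
  intro i hi
  rw [dlen0] at hi
  by_cases h0 : i < 150
  · exact ⟨0, 150, by omega, by omega, census0_0⟩
  by_cases h1 : i < 300
  · exact ⟨150, 150, by omega, by omega, census0_1⟩
  · exact ⟨300, 60, by omega, by omega, census0_2⟩

set_option maxHeartbeats 0 in
/-- Group `cX1`: the certificate list has the length of the instance list (184). -/
theorem len1 : (instOf cX1).length = data1.length := by
  decide +kernel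

/-- Group `cX1`: number of certificates. -/
theorem dlen1 : data1.length = 184 := by
  decide +kernel

set_option maxHeartbeats 0 in
/-- CENSUS, group `cX1`, instances `0 … 149` (kernel-decided): each certificate decodes to a valid
perfect matching of its instance. -/
theorem census1_0 : ((((instOf cX1).zip data1).drop 0).take 150).all
    (fun p => goodD p.1 p.2) = true := by
  decide +kernel

set_option maxHeartbeats 0 in
/-- CENSUS, group `cX1`, instances `150 … 183` (kernel-decided): each certificate decodes to a valid
perfect matching of its instance. -/
theorem census1_1 : ((((instOf cX1).zip data1).drop 150).take 34).all
    (fun p => goodD p.1 p.2) = true := by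
  decide +kernel

/-- Group `cX1`: every index is covered by a decided chunk. -/
theorem cover1 : ∀ i < data1.length, ∃ lo n, lo ≤ i ∧ i < lo + n ∧
    ((((instOf cX1).zip data1).drop lo).take n).all (fun p => goodD p.1 p.2) = true := by
  intro i hi
  rw [dlen1] at hi
  by_cases h0 : i < 150
  · exact ⟨0, 150, by omega, by omega, census1_0⟩
  · exact ⟨150, 34, by omega, by omega, census1_1⟩

set_option maxHeartbeats 0 in
/-- Group `cX2`: the certificate list has the length of the instance list (376). -/
theorem len2 : (instOf cX2).length = data2.length := by
  decide +kernel

/-- Group `cX2`: number of certificates. -/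
theorem dlen2 : data2.length = 376 := by
  decide +kernel

set_option maxHeartbeats 0 in
/-- CENSUS, group `cX2`, instances `0 … 149` (kernel-decided): each certificate decodes to a valid
perfect matching of its instance. -/
theorem census2_0 : ((((instOf cX2).zip data2).drop 0).take 150).all
    (fun p => goodD p.1 p.2) = true := by
  decide +kernel

set_option maxHeartbeats 0 in
/-- CENSUS, group `cX2`, instances `150 … 299` (kernel-decided): each certificate decodes to a valid
perfect matching of its instance. -/
theorem census2_1 : ((((instOf cX2).zip data2).drop 150).take 150).all
    (fun p => goodD p.1 p.2) = true := by
  decide +kernel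

set_option maxHeartbeats 0 in
/-- CENSUS, group `cX2`, instances `300 … 375` (kernel-decided): each certificate decodes to a valid
perfect matching of its instance. -/
theorem census2_2 : ((((instOf cX2).zip data2).drop 300).take 76).all
    (fun p => goodD p.1 p.2) = true := by
  decide +kernel

/-- Group `cX2`: every index is covered by a decided chunk. -/
theorem cover2 : ∀ i < data2.length, ∃ lo n, lo ≤ i ∧ i < lo + n ∧
    ((((instOf cX2).zip data2).drop lo).take n).all (fun p => goodD p.1 p.2) = true := by
  intro i hi
  rw [dlen2] at hi
  by_cases h0 : i < 150
  · exact ⟨0, 150, by omega, by omega, census2_0⟩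
  by_cases h1 : i < 300
  · exact ⟨150, 150, by omega, by omega, census2_1⟩
  · exact ⟨300, 76, by omega, by omega, census2_2⟩

end Summit.MatrixMultiplication.MatrixMultiplication.Theorems.OutsiderSandwichToricCeilingPowTwoCwBaseCensusA
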